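import Mathlib
import HarnessLib

/-!
# Crux `NewtonUnitEquations.DissociatedUniform` (stmt-ValiantsHypothesis-5905): totals law, the binary row — RUNS of a weighted nearest-root labelling

Tool file for the `q = 2` row of the typed general totals law `TotalsLawN.TotalsLawGeneral` (companion files
`…TotalsLawBinaryCharts`, `…TotalsLawBinaryWalk`, `…TotalsLawBinary`).  Along an affine chart of weights `t ↦ (σ, t)` the
parity-class tops of a binary (`G = ℤ/2`) design are governed by the index minimising `|α_i + β_i t|` (memo
`Cruxes/DissociatedUniform/NOTES-t1.md` §5(iv), crit-3 S2: the located `q = 2` row).  The number of times this ARGMIN LABEL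
changes along a finite increasing sample of times is at most `2m - 2`, `m` the number of labels that occur — the linear bound for
the lower envelope of `m` functions pairwise crossing at most twice (a Davenport–Schinzel sequence of order 2; equivalently the
one-dimensional multiplicatively weighted Voronoi diagram has `≤ 2m - 1` cells).  We prove it abstractly, for labels `d` carrying
comparison functions `Q d : ℝ → ℝ` with a "steepness" `lead d` such that `{t | Q d t < Q d' t}` is convex whenever
`lead d' ≤ lead d`: remove the steepest label (its samples form one contiguous block, costing at most two changes) and induct.

What is here: `IsPred` (immediate predecessor in a finite set of reals), `changePts S f` (samples whose predecessor has another
label), the block lemma `card_changePts_le_of_block`, and the runs theorem `card_changePts_add_two_le`.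
[folklore: Davenport–Schinzel sequences of order 2 have length ≤ 2n − 1]
-/

set_option linter.dupNamespace false -- `ValiantsHypothesis.ValiantsHypothesis` (summit = problem) in every name

open scoped Classical

namespace Summit.ValiantsHypothesis.ValiantsHypothesis.Theorems.NewtonUnitEquationsDissociatedUniform

namespace TotalsLawN

namespace Binary

/-- `IsPred S p s`: `p` is the immediate predecessor of `s` in the finite set `S ⊂ ℝ` (`p ∈ S`, `p < s`, nothing of `S`
strictly between). -/
def IsPred (S : Finset ℝ) (p s : ℝ) : Prop :=
  p ∈ S ∧ p < s ∧ ∀ u ∈ S, ¬ (p < u ∧ u < s)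

/-- The CHANGE POINTS of a labelling `f` along `S`: the members of `S` whose immediate predecessor in `S` carries a different
label.  Their number is the number of label changes of the sequence `f` read along `S` in increasing order. -/
noncomputable def changePts {κ : Type*} (S : Finset ℝ) (f : ℝ → κ) : Finset ℝ :=
  S.filter fun s => ∃ p, IsPred S p s ∧ f p ≠ f s

/-- Immediate predecessors are unique. [folklore] -/
theorem IsPred.unique {S : Finset ℝ} {p p' s : ℝ} (h : IsPred S p s) (h' : IsPred S p' s) : p = p' := by
  by_contra hne
  rcases lt_or_gt_of_ne hne with hlt | hlt
  · exact h.2.2 p' h'.1 ⟨hlt, h'.2.1⟩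
  · exact h'.2.2 p h.1 ⟨hlt, h.2.1⟩

/-- A member of `S` with some smaller member has an immediate predecessor. [folklore] -/
theorem exists_isPred {S : Finset ℝ} {s u : ℝ} (hu : u ∈ S) (hus : u < s) : ∃ p, IsPred S p s := by
  have hne : (S.filter fun x => x < s).Nonempty := ⟨u, Finset.mem_filter.2 ⟨hu, hus⟩⟩
  refine ⟨(S.filter fun x => x < s).max' hne, (Finset.mem_filter.1 (Finset.max'_mem _ hne)).1,
    (Finset.mem_filter.1 (Finset.max'_mem _ hne)).2, fun w hw hpw => ?_⟩
  have : w ≤ (S.filter fun x => x < s).max' hne := Finset.le_max' _ w (Finset.mem_filter.2 ⟨hw, hpw.2⟩)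
  exact absurd hpw.1 (not_lt.2 this)

/-- Change points are members. [folklore] -/
theorem changePts_subset {κ : Type*} (S : Finset ℝ) (f : ℝ → κ) : changePts S f ⊆ S :=
  Finset.filter_subset _ _

/-- Membership in the change points. [folklore] -/
theorem mem_changePts {κ : Type*} {S : Finset ℝ} {f : ℝ → κ} {s : ℝ} :
    s ∈ changePts S f ↔ s ∈ S ∧ ∃ p, IsPred S p s ∧ f p ≠ f s :=
  Finset.mem_filter

/-- **Block lemma.**  If the samples carrying the label `a` form a contiguous block of `S`, then deleting them loses at most
two change points (the first sample of the block and the first sample after it). [folklore] -/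
theorem card_changePts_le_of_block {κ : Type*} (S : Finset ℝ) (f : ℝ → κ) (a : κ)
    (hcont : ∀ s₁ ∈ S, ∀ s₂ ∈ S, ∀ u ∈ S, f s₁ = a → f s₂ = a → s₁ ≤ u → u ≤ s₂ → f u = a) :
    (changePts S f).card ≤ (changePts (S.filter fun s => f s ≠ a) f).card + 2 := by
  set S' := S.filter fun s => f s ≠ a with hS'
  set C := changePts S f with hC
  -- three kinds of change points
  set C₁ := C.filter fun s => f s = a with hC₁
  set C₂ := C.filter fun s => f s ≠ a ∧ ∃ p, IsPred S p s ∧ f p = a with hC₂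
  set C₃ := C.filter fun s => f s ≠ a ∧ ∃ p, IsPred S p s ∧ f p ≠ a with hC₃
  have hcover : C ⊆ C₁ ∪ C₂ ∪ C₃ := by
    intro s hs
    obtain ⟨hsS, p, hp, hne⟩ := mem_changePts.1 hs
    by_cases hsa : f s = a
    · exact Finset.mem_union.2 (Or.inl (Finset.mem_union.2 (Or.inl (Finset.mem_filter.2 ⟨hs, hsa⟩))))
    · by_cases hpa : f p = a
      · exact Finset.mem_union.2 (Or.inl (Finset.mem_union.2 (Or.inr
          (Finset.mem_filter.2 ⟨hs, hsa, p, hp, hpa⟩))))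
      · exact Finset.mem_union.2 (Or.inr (Finset.mem_filter.2 ⟨hs, hsa, p, hp, hpa⟩))
  -- the third kind survives the deletion
  have h₃ : C₃ ⊆ changePts S' f := by
    intro s hs
    obtain ⟨hsC, hsa, p, hp, hpa⟩ := Finset.mem_filter.1 hs
    obtain ⟨hsS, p', hp', hne⟩ := mem_changePts.1 hsC
    have hpp : p' = p := hp'.unique hp
    subst hpp
    refine mem_changePts.2 ⟨Finset.mem_filter.2 ⟨hsS, hsa⟩, p', ⟨Finset.mem_filter.2 ⟨hp'.1, hpa⟩, hp'.2.1,
      fun u hu => hp'.2.2 u (Finset.mem_filter.1 hu).1⟩, hne⟩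
  -- at most one change point inside the block
  have h₁ : C₁.card ≤ 1 := by
    refine Finset.card_le_one.2 fun s₁ hs₁ s₂ hs₂ => ?_
    obtain ⟨hs₁C, hs₁a⟩ := Finset.mem_filter.1 hs₁
    obtain ⟨hs₂C, hs₂a⟩ := Finset.mem_filter.1 hs₂
    obtain ⟨hs₁S, p₁, hp₁, hne₁⟩ := mem_changePts.1 hs₁C
    obtain ⟨hs₂S, p₂, hp₂, hne₂⟩ := mem_changePts.1 hs₂C
    by_contra hne
    rcases lt_or_gt_of_ne hne with hlt | hlt
    · -- `s₁ < s₂`: the predecessor of `s₂` lies in `[s₁, s₂)`, inside the block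
      have hle : s₁ ≤ p₂ := not_lt.1 fun h => hp₂.2.2 s₁ hs₁S ⟨h, hlt⟩
      exact hne₂ (by rw [hs₂a]; exact hcont s₁ hs₁S s₂ hs₂S p₂ hp₂.1 hs₁a hs₂a hle hp₂.2.1.le)
    · have hle : s₂ ≤ p₁ := not_lt.1 fun h => hp₁.2.2 s₂ hs₂S ⟨h, hlt⟩
      exact hne₁ (by rw [hs₁a]; exact hcont s₂ hs₂S s₁ hs₁S p₁ hp₁.1 hs₂a hs₁a hle hp₁.2.1.le)
  -- at most one change point right after the block
  have h₂ : C₂.card ≤ 1 := by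
    refine Finset.card_le_one.2 fun s₁ hs₁ s₂ hs₂ => ?_
    obtain ⟨hs₁C, hs₁a, p₁, hp₁, hp₁a⟩ := Finset.mem_filter.1 hs₁
    obtain ⟨hs₂C, hs₂a, p₂, hp₂, hp₂a⟩ := Finset.mem_filter.1 hs₂
    have hs₁S : s₁ ∈ S := changePts_subset S f hs₁C
    have hs₂S : s₂ ∈ S := changePts_subset S f hs₂C
    by_contra hne
    rcases lt_or_gt_of_ne hne with hlt | hlt
    · have hle : s₁ ≤ p₂ := not_lt.1 fun h => hp₂.2.2 s₁ hs₁S ⟨h, hlt⟩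
      have hlt' : s₁ < p₂ := lt_of_le_of_ne hle fun h => hs₁a (by rw [h]; exact hp₂a)
      exact hs₁a (hcont p₁ hp₁.1 p₂ hp₂.1 s₁ hs₁S hp₁a hp₂a hp₁.2.1.le hlt'.le)
    · have hle : s₂ ≤ p₁ := not_lt.1 fun h => hp₁.2.2 s₂ hs₂S ⟨h, hlt⟩
      have hlt' : s₂ < p₁ := lt_of_le_of_ne hle fun h => hs₂a (by rw [h]; exact hp₁a)
      exact hs₂a (hcont p₂ hp₂.1 p₁ hp₁.1 s₂ hs₂S hp₂a hp₁a hp₂.2.1.le hlt'.le)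
  calc C.card ≤ (C₁ ∪ C₂ ∪ C₃).card := Finset.card_le_card hcover
    _ ≤ (C₁ ∪ C₂).card + C₃.card := Finset.card_union_le _ _
    _ ≤ C₁.card + C₂.card + C₃.card := Nat.add_le_add_right (Finset.card_union_le _ _) _
    _ ≤ 1 + 1 + (changePts S' f).card := add_le_add (add_le_add h₁ h₂) (Finset.card_le_card h₃)
    _ = (changePts S' f).card + 2 := by ring

/-- If every sample carries the same label there are no change points. [folklore] -/
theorem changePts_eq_empty_of_const {κ : Type*} {S : Finset ℝ} {f : ℝ → κ} {a : κ} (h : ∀ s ∈ S, f s = a) :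
    changePts S f = ∅ := by
  refine Finset.eq_empty_of_forall_notMem fun s hs => ?_
  obtain ⟨hsS, p, hp, hne⟩ := mem_changePts.1 hs
  exact hne (by rw [h s hsS, h p hp.1])

/-- **Runs theorem** (the steepest-label induction).  Labels `d : κ` carry comparison functions `Q d : ℝ → ℝ` and a steepness
`lead d`, with `{t | Q d t < Q d' t}` convex whenever `lead d' ≤ lead d`.  If along the finite sample `S` the label `f s`
is the STRICT minimiser of `Q · s` among a finite label set `L ∋ f s`, then the labelling changes at most `2·#L - 2` times:
`#changePts + 2 ≤ 2·#L`.  (The samples of the steepest label form one block; delete it and induct.)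
[folklore: Davenport–Schinzel sequences of order 2 have length ≤ 2n − 1] -/
theorem card_changePts_add_two_le {κ : Type*} (Q : κ → ℝ → ℝ) (lead : κ → ℝ)
    (hQ : ∀ d d', lead d' ≤ lead d → Convex ℝ {t : ℝ | Q d t < Q d' t}) :
    ∀ (L : Finset κ) (S : Finset ℝ) (f : ℝ → κ), S.Nonempty → (∀ s ∈ S, f s ∈ L) →
      (∀ s ∈ S, ∀ d ∈ L, d ≠ f s → Q (f s) s < Q d s) → (changePts S f).card + 2 ≤ 2 * L.card := by
  intro L
  induction' hL : L.card using Nat.strong_induction_on with k ih generalizing L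
  intro S f hS hfL hmin
  subst hL
  obtain ⟨s₀, hs₀⟩ := hS
  have hLne : L.Nonempty := ⟨f s₀, hfL s₀ hs₀⟩
  -- the steepest label
  obtain ⟨a, haL, hamax⟩ := L.exists_max_image lead hLne
  -- its samples form a block
  have hcont : ∀ s₁ ∈ S, ∀ s₂ ∈ S, ∀ u ∈ S, f s₁ = a → f s₂ = a → s₁ ≤ u → u ≤ s₂ → f u = a := by
    intro s₁ hs₁ s₂ hs₂ u hu h₁ h₂ h1u hu2
    by_contra hua
    -- at `u`, the steepest label beats every other label of `L`, in particular `f u`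
    have hlt : Q a u < Q (f u) u := by
      have hconv := hQ a (f u) (hamax (f u) (hfL u hu))
      have hu1 : s₁ ∈ {t : ℝ | Q a t < Q (f u) t} := by
        have := hmin s₁ hs₁ (f u) (hfL u hu) (by rw [h₁]; exact hua)
        rw [h₁] at this; exact this
      have hu2' : s₂ ∈ {t : ℝ | Q a t < Q (f u) t} := by
        have := hmin s₂ hs₂ (f u) (hfL u hu) (by rw [h₂]; exact hua)
        rw [h₂] at this; exact this
      exact (hconv.ordConnected.out hu1 hu2' ⟨h1u, hu2⟩)
    have hlt' : Q (f u) u < Q a u := hmin u hu a haL (fun h => hua h.symm)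
    exact lt_asymm hlt hlt'
  have hblock := card_changePts_le_of_block S f a hcont
  set S' := S.filter fun s => f s ≠ a with hS'
  by_cases hS'e : S'.Nonempty
  · -- induct on the remaining labels
    have hcard : (L.erase a).card < L.card := Finset.card_erase_lt_of_mem haL
    have hfL' : ∀ s ∈ S', f s ∈ L.erase a := fun s hs =>
      Finset.mem_erase.2 ⟨(Finset.mem_filter.1 hs).2, hfL s (Finset.mem_filter.1 hs).1⟩
    have hmin' : ∀ s ∈ S', ∀ d ∈ L.erase a, d ≠ f s → Q (f s) s < Q d s := fun s hs d hd hne =>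
      hmin s (Finset.mem_filter.1 hs).1 d (Finset.mem_of_mem_erase hd) hne
    have hih := ih (L.erase a).card hcard (L.erase a) rfl S' f hS'e hfL' hmin'
    have hca : (L.erase a).card + 1 = L.card := Finset.card_erase_add_one haL
    omega
  · -- every sample carries the label `a`
    have hall : ∀ s ∈ S, f s = a := by
      intro s hs
      by_contra h
      exact hS'e ⟨s, Finset.mem_filter.2 ⟨hs, h⟩⟩
    rw [changePts_eq_empty_of_const hall, Finset.card_empty]
    have : 1 ≤ L.card := Finset.card_pos.2 hLne
    omega

end Binary

end TotalsLawN

end Summit.ValiantsHypothesis.ValiantsHypothesis.Theorems.NewtonUnitEquationsDissociatedUniform
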